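/-
Copyright (c) 2026 the pub-hodgecm-mathlib formalisation cell (harness21).  Prover seat hodgecm-mathlib-LH4-p10 (g3): dealer LH4-plan (g12) WORD #1 (4)(iii) «★ K-SGN-R2 TRANSPORT HEAD»
under the (R-22) «κS-RECUT» (heir LEAD F0P3a-plan (g19) T18-50 (d); pen SHAPE MEMO v1 668606e998450a1b §2–§3 (iii)).  The Ω-aware twin of ★ p855598 (F0P3-p01 (g30)).  2026-09-04.
-/
import Summits.HodgeConjecture.HodgeConjecture.Theorems.F0P3cDyRamFourFrameLawDefsR2             -- DEFS LEAF №1-R2 (this seat): `OmegaSchedule`, `KappaSignLawAtS2 shift Ω`, `KappaSignLawAtR2 Ω`; brings ★ №1-R, ★ №1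
import Summits.HodgeConjecture.HodgeConjecture.Theorems.F0P3cDyRamKappaSignLawOfKappaModelSum    -- ★ p855598 (F0P3-p01 (g30)): `eq_of_two_mul_eq_of_eq_two_mul`, `two_mul_kappaSum_eq_unitSign_mul_chiSum`; brings ★ p855529, ★ p855505, ★ p855402 `normIndexTwo`, ★ p855115 `normSign_eq_one_or`
import HarnessLib

/-!
# F0 · P3c · line LH4 «(D-RAM) FOUR-FRAME» — unit U3 §K-R2 (R-22 «κS-RECUT»): THE Ω-AWARE κ-SIGN LAW AT A DATUM FROM (NI2) + THE Ω-AWARE EIGHTFOLD SIGNED κ-MODEL SUM (KSS²)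
# — the transport head `dyadicFence_kappaSignLawAtR2_of_kappaSignModelSum2_8` (Rogawski 1990 §3.6, §4.9 Prop. 4.9.1 (a); Langlands–Shelstad 1987 §1.3)

Cell `pub/hodgecm-mathlib`, crux H413 = `stmt-HodgeConjecture-24833` (helper lane `--supports stmt-HodgeConjecture-24833 --as helper`), route HCCMUnconditional; THEOREMS ONLY
(no definition, no instance, no notation, no named fact, no `sorry`, no `set_option` beyond `autoImplicit false`; default heartbeats).

WHAT IS PROVED — the Ω-AWARE twin of ★ p855598 `kappaSignLawAtS_of_normIndexTwo_of_kappaSignModelSum8` (R-22: the κ-sign law's sign `S_i` carries a further token `Ω_i = Ω K σ ϖ d a b i`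
read off a SCHEDULE `Ω : OmegaSchedule` of DEFS LEAF №1-R2; the law of record is the instance `Ω ≡ 1`, the recut instance is the glue-sign schedule `ΩR` typed over LH4-p04 (g2)'s Ω-defs leaf).
For ANY depth-shift schedule `shift`, ANY sign-token schedule `Ω`, threshold `N₀`, type shift `τ` and datum `(K, σ, ϖ, d, t)`: if (NI2) some `σ`-fixed unit `c` satisfies the index-two
dichotomy and (KSS²) for every such `c`, every anti-fixed `δ ≠ 0`, every `a, b` with `aσa = bσb = 1`, `v(a − 1), v(b − 1) < v 2`, every element datum `(a², b²; n₁, n₂, n₃)` at `N₀ d`,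
`T = diag(a², b², 1)`, every `k` with `2k + d = Σn + 2`, every `i` and parity datum `2B = n_i − d + 2 − 2·shift d t`:
  `Σ_{s : Fin 3 → Bool} χ⁰_i(s)·C₀(s) = 2·(Ω_i·w_i·S_i)·ampl q k B`  and  `Σ_s χ⁰_i(s)·C₂(s) = 2·(Ω_i·w_i·S_i)·ampl q k (B + τ d)`  (over `ℚ`; SHAPE MEMO v1 §2: «the :592 statement with
both conjuncts' RHS sign multiplied by `Ωtok i`»), with `C_t(s)`, `χ⁰_i`, `w_i = (w, w, 1)_i`, `w = normSign σ (−1)`, `S_i = baseSign σ i · normSign σ (fPartProd δ (a, b, 1) i)` EXACTLY as in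
★ p855598 — THEN `KappaSignLawAtS2 shift Ω N₀ τ σ ϖ d t` (№1-R2 §S2, sign-exact): `kappaSignLawAtS2_of_normIndexTwo_of_kappaSignModelSum2_8`.  At `(shiftR, depthOfRecord, tauOfRecord)`
with (NI2) DISCHARGED by ★ `normIndexTwo`:  **`dyadicFence_kappaSignLawAtR2_of_kappaSignModelSum2_8 (Ω) (σ ϖ d t) (hKSS²) : DyadicFence (KappaSignLawAtR2 Ω depthOfRecord tauOfRecord σ ϖ d t)`**
— the conclusion of the recut stub `stub_U3_kappaSignLawR2` at the datum from ONE frame-free binder (KSS²).  Nothing is claimed about (KSS²): it is a BINDER (the Fκ6-2 head of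
LH4-p14 (g3) pays it from (κ-A₂) + (κS-B₀²) + (κS-B₂²)).

THE MATHEMATICS (unchanged from ★ p855598; the token rides through).  ★ p855505: `2·X = Σ_s χ_i(s)·C_t(s)` for `X = Σ_b κ_i(b)·n_t(Γ_b)`; ★ p855529 §1: `Σ_s χ_i(s)·C_t(s) = w_i·Y`,
`Y = Σ_s χ⁰_i(s)·C_t(s)`; (KSS²): `Y = 2·(Ω_i w_i S_i)·A`; `w_i² = 1` (★ `normSign_eq_one_or`) — so `2X = w_i·Y = 2·w_i²·(Ω_i S_i)·A`, i.e. `X = (Ω_i S_i)·A`, the K-SGN-S2 clause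
(★ `eq_of_two_mul_eq_of_eq_two_mul` at `S := Ω_i S_i`, pure `ℚ`-algebra).

EVIDENCE HONESTY.  (KSS²) is the ALGEBRAIC TRANSPORT of K-SGN-R2 (equivalent to it under (NI2) + ★ p855505, factor `2·w_i`); its evidence is the R-22 tally (REF5 R5-109 (3) ∕ R5-114 ∕
R5-115, LH4-p05 (g3), LH4-p04 (g2) ★ p856880, LH4-r01 (g4) GD∕GD2, LHref-N #343) for the glue-sign schedule.  A census law in model currency — a PROVER TARGET, never a literature fact.

* §1 **`kappaSignLawAtS2_of_normIndexTwo_of_kappaSignModelSum2_8`**, `dyadicFence_kappaSignLawAtS2_of_normIndexTwo_of_kappaSignModelSum2_8`, **`dyadicFence_kappaSignLawAtR2_of_kappaSignModelSum2_8`**.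

HONEST LABEL: HC_CM is proved only modulo the 7 printed citations (2 remaining named inputs: hLiu418 = stmt-HodgeConjecture-24832, h413 = stmt-HodgeConjecture-24833) until
rung 0 closes; count-neutral (`--supports … --as helper`); the verdict of record for (D-RAM) stays PRINT [LanglandsShelstad1989 Thm. p. 484 ∕ Rogawski1990 Prop. 4.9.1 (a)].

## References
* [Rogawski1990] J. D. Rogawski, *Automorphic Representations of Unitary Groups in Three Variables*, Ann. of Math. Stud. 123 (1990), §3.6 pp. 28–29, §4.9 Prop. 4.9.1 (a) p. 55, §12.2.
* [LanglandsShelstad1987] R. P. Langlands, D. Shelstad, *On the definition of transfer factors*, Math. Ann. 278 (1987), §1.3 (the κ-signs of the classes in a stable class).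
* [Jacobowitz1962] R. Jacobowitz, *Hermitian forms over local fields*, Amer. J. Math. 84 (1962), §4.
-/

set_option autoImplicit false

noncomputable section

namespace Summit.HodgeConjecture.HodgeConjecture.Cruxes.H413.F0P3cDyRamKappaSignLawR2OfKappaSignModelSum

open Matrix
open Literature.NumberTheory.Automorphic Literature.NumberTheory.Automorphic.HermitianLattice Literature.NumberTheory.Automorphic.UnitaryGroup
open Literature.NumberTheory.Automorphic.UnitaryLatticeTree Literature.NumberTheory.Automorphic.UnitaryThreeFourFrame
open Summit.HodgeConjecture.HodgeConjecture.Cruxes.H413.F0P3cDyRamStableSumSignClasses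
open Summit.HodgeConjecture.HodgeConjecture.Cruxes.H413.F0P3cDyRamKappaSumSignClasses
open Summit.HodgeConjecture.HodgeConjecture.Cruxes.H413.F0P3cDyRamKappaAbsLawOfKappaModelSum
open Summit.HodgeConjecture.HodgeConjecture.Cruxes.H413.F0P3cDyRamKappaSignLawOfKappaModelSum
open Summit.HodgeConjecture.HodgeConjecture.Cruxes.H413.F0P3cDyRamFourFrameLawDefs
open Summit.HodgeConjecture.HodgeConjecture.Cruxes.H413.F0P3cDyRamFourFrameLawDefsR
open Summit.HodgeConjecture.HodgeConjecture.Cruxes.H413.F0P3cDyRamFourFrameLawDefsR2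
open Summit.HodgeConjecture.HodgeConjecture.Cruxes.H413.F0P3cDyRamNormIndexTwo
open scoped Valued WithZero Matrix MatrixGroups

/-! ## §1 The Ω-aware κ-sign law at a datum from (NI2) + (KSS²); the record instance with (NI2) discharged by ★ `normIndexTwo` -/

section Reduction

variable {K : Type} [Field K] [Valued K ℤᵐ⁰] [CompleteSpace K] [Fintype 𝓀[K]]

/-- **THE Ω-AWARE κ-SIGN LAW AT A DATUM FROM (NI2) + THE Ω-AWARE EIGHTFOLD SIGNED κ-MODEL SUM (KSS²)** (any depth-shift schedule `shift`, any sign-token schedule `Ω`, threshold `N₀`,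
type shift `τ`): `KappaSignLawAtS2 shift Ω N₀ τ σ ϖ d t` (★ №1-R2 §S2 verbatim, sign-exact) follows from a `σ`-fixed unit `c` with the index-two dichotomy (NI2) and (KSS²): for every such
`c`, anti-fixed `δ ≠ 0`, `a, b` with `aσa = bσb = 1`, `v(a−1), v(b−1) < v 2`, element datum `(a², b²; n)` at `N₀ d`, `T = diag(a², b², 1)`, `2k + d = Σn + 2`, `i`, `2B = n_i − d + 2 − 2·shift d t`:
`Σ_s χ⁰_i(s)·C₀(s) = 2·(Ω_i·w_i·S_i)·ampl q k B ∧ Σ_s χ⁰_i(s)·C₂(s) = 2·(Ω_i·w_i·S_i)·ampl q k (B + τ d)` with `Ω_i = Ω K σ ϖ d a b i`, `w_i = (w, w, 1)_i`, `w = normSign σ (−1)`,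
`S_i = baseSign σ i · normSign σ (fPartProd δ (a, b, 1) i)` — by ★ p855598 §1 (`2X = w_i·Y`, `Y = 2·w_i·(Ω_i S_i)·A`, `w_i² = 1 ⇒ X = (Ω_i S_i)·A`): the token rides through the algebra
untouched. [cite: Rogawski1990, §4.9 Prop. 4.9.1 (a) p. 55] [cite: LanglandsShelstad1987, §1.3] -/
theorem kappaSignLawAtS2_of_normIndexTwo_of_kappaSignModelSum2_8 (shift : ℕ → ℕ → ℤ) (Ω : OmegaSchedule) (N₀ : ℕ → ℕ) (τ : ℕ → ℤ) (σ : K →+* K) (ϖ : K) (d t : ℕ)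
    (hNI : ∃ c : K, σ c = c ∧ Valued.v c = 1 ∧ ∀ x : K, σ x = x → x ≠ 0 → (∃ z : K, z * σ z = x) ∨ ∃ z : K, z * σ z = c * x)
    (hKSS : ∀ c : K, σ c = c → Valued.v c = 1 → (∀ x : K, σ x = x → x ≠ 0 → (∃ z : K, z * σ z = x) ∨ ∃ z : K, z * σ z = c * x) →
      ∀ (δ : K), σ δ = -δ → δ ≠ 0 →
      ∀ (a b : K), a * σ a = 1 → b * σ b = 1 → Valued.v (a - 1) < Valued.v (2 : K) → Valued.v (b - 1) < Valued.v (2 : K) →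
      ∀ (n₁ n₂ n₃ : ℕ), IsElementDatum σ ϖ (N₀ d) (a * a) (b * b) n₁ n₂ n₃ →
      ∀ (T : GL (Fin 3) K), (T : Matrix (Fin 3) (Fin 3) K) = Matrix.diagonal ![a * a, b * b, 1] →
      ∀ (k : ℕ), 2 * k + d = n₁ + n₂ + n₃ + 2 →
      ∀ (i : Fin 3) (B : ℤ), 2 * B = ((![n₁, n₂, n₃] : Fin 3 → ℕ) i : ℤ) - d + 2 - 2 * shift d t →
        ((∑ s : Fin 3 → Bool,
            (![(if s 1 then -1 else 1) * (if s 2 then -1 else 1),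
               (if s 0 then -1 else 1) * (if s 2 then -1 else 1),
               (if s 0 then -1 else 1) * (if s 1 then -1 else 1)] : Fin 3 → ℤ) i *
              ({M : Submodule 𝒪[K] (Fin 3 → K) |
                IsVertexLattice σ ϖ (Matrix.diagonal fun j => if s j then c else (1 : K)) 0 M ∧ mapGL T M = M}.ncard : ℤ) : ℤ) : ℚ) =
          2 * ((Ω K σ ϖ d a b i * ((![normSign σ (-1 : K), normSign σ (-1 : K), 1] : Fin 3 → ℤ) i *
            (baseSign σ i * normSign σ (fPartProd δ ![a, b, 1] i))) : ℤ) : ℚ) * ampl (Fintype.card 𝓀[K]) k B ∧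
        ((∑ s : Fin 3 → Bool,
            (![(if s 1 then -1 else 1) * (if s 2 then -1 else 1),
               (if s 0 then -1 else 1) * (if s 2 then -1 else 1),
               (if s 0 then -1 else 1) * (if s 1 then -1 else 1)] : Fin 3 → ℤ) i *
              ({M : Submodule 𝒪[K] (Fin 3 → K) |
                IsVertexLattice σ ϖ (Matrix.diagonal fun j => if s j then c else (1 : K)) 2 M ∧ mapGL T M = M}.ncard : ℤ) : ℤ) : ℚ) =
          2 * ((Ω K σ ϖ d a b i * ((![normSign σ (-1 : K), normSign σ (-1 : K), 1] : Fin 3 → ℤ) i *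
            (baseSign σ i * normSign σ (fPartProd δ ![a, b, 1] i))) : ℤ) : ℚ) * ampl (Fintype.card 𝓀[K]) k (B + τ d)) :
    KappaSignLawAtS2 shift Ω N₀ τ σ ϖ d t := by
  intro hD f hf δ hσδ hδ0 a b ha hb ha1 hb1 n₁ n₂ n₃ hE Γ hΓ k hk i B hB
  obtain ⟨hσ, hvσ, hϖ, heven, -, -, -⟩ := hD
  obtain ⟨c, hσc, hvc, hdich⟩ := hNI
  -- `a, b` are units (`a·σa = 1`)
  have ha0 : a ≠ 0 := fun h => by rw [h, zero_mul] at ha; exact zero_ne_one ha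
  have hb0 : b ≠ 0 := fun h => by rw [h, zero_mul] at hb; exact zero_ne_one hb
  -- the diagonal literal `T = diag(a², b², 1)` as a `GL₃` element
  obtain ⟨α, hα⟩ : ∃ α : K, α = a * a := ⟨_, rfl⟩
  obtain ⟨β, hβ⟩ : ∃ β : K, β = b * b := ⟨_, rfl⟩
  have hα0 : α ≠ 0 := hα ▸ mul_ne_zero ha0 ha0
  have hβ0 : β ≠ 0 := hβ ▸ mul_ne_zero hb0 hb0
  let T : GL (Fin 3) K :=
    ⟨Matrix.diagonal ![α, β, 1], Matrix.diagonal ![α⁻¹, β⁻¹, 1],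
      by rw [Matrix.diagonal_mul_diagonal, ← Matrix.diagonal_one]; congr 1; funext j; fin_cases j <;> simp [hα0, hβ0],
      by rw [Matrix.diagonal_mul_diagonal, ← Matrix.diagonal_one]; congr 1; funext j; fin_cases j <;> simp [hα0, hβ0]⟩
  have hT : (T : Matrix (Fin 3) (Fin 3) K) = Matrix.diagonal ![a * a, b * b, 1] := by rw [← hα, ← hβ]
  obtain ⟨hK0, hK2⟩ := hKSS c hσc hvc hdich δ hσδ hδ0 a b ha hb ha1 hb1 n₁ n₂ n₃ hE T hT k hk i B hB
  have h0 := two_mul_kappaSum_eq_unitSign_mul_chiSum hσ hvσ hϖ heven hσc hvc hdich hf (a * a) (b * b) T hT Γ hΓ 0 i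
  have h2 := two_mul_kappaSum_eq_unitSign_mul_chiSum hσ hvσ hϖ heven hσc hvc hdich hf (a * a) (b * b) T hT Γ hΓ 2 i
  -- `w_i = ±1`
  have hw : (((![normSign σ (-1 : K), normSign σ (-1 : K), 1] : Fin 3 → ℤ) i : ℤ) : ℚ) = 1 ∨
      (((![normSign σ (-1 : K), normSign σ (-1 : K), 1] : Fin 3 → ℤ) i : ℤ) : ℚ) = -1 := by
    rcases normSign_eq_one_or σ (-1 : K) with h | h <;> rw [h] <;> fin_cases i <;> simp
  constructor
  · refine eq_of_two_mul_eq_of_eq_two_mul hw h0 ?_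
    rw [hK0]; push_cast; ring
  · refine eq_of_two_mul_eq_of_eq_two_mul hw h2 ?_
    rw [hK2]; push_cast; ring

/-- **THE FENCED FORM**: `DyadicFence (KappaSignLawAtS2 shift Ω N₀ τ σ ϖ d t)` from (NI2) + (KSS²) (★ №1 `dyadicFence_of`). [cite: Rogawski1990, §4.9 Prop. 4.9.1 (a) p. 55] -/
theorem dyadicFence_kappaSignLawAtS2_of_normIndexTwo_of_kappaSignModelSum2_8 (shift : ℕ → ℕ → ℤ) (Ω : OmegaSchedule) (N₀ : ℕ → ℕ) (τ : ℕ → ℤ) (σ : K →+* K) (ϖ : K) (d t : ℕ)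
    (hNI : ∃ c : K, σ c = c ∧ Valued.v c = 1 ∧ ∀ x : K, σ x = x → x ≠ 0 → (∃ z : K, z * σ z = x) ∨ ∃ z : K, z * σ z = c * x)
    (hKSS : ∀ c : K, σ c = c → Valued.v c = 1 → (∀ x : K, σ x = x → x ≠ 0 → (∃ z : K, z * σ z = x) ∨ ∃ z : K, z * σ z = c * x) →
      ∀ (δ : K), σ δ = -δ → δ ≠ 0 →
      ∀ (a b : K), a * σ a = 1 → b * σ b = 1 → Valued.v (a - 1) < Valued.v (2 : K) → Valued.v (b - 1) < Valued.v (2 : K) →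
      ∀ (n₁ n₂ n₃ : ℕ), IsElementDatum σ ϖ (N₀ d) (a * a) (b * b) n₁ n₂ n₃ →
      ∀ (T : GL (Fin 3) K), (T : Matrix (Fin 3) (Fin 3) K) = Matrix.diagonal ![a * a, b * b, 1] →
      ∀ (k : ℕ), 2 * k + d = n₁ + n₂ + n₃ + 2 →
      ∀ (i : Fin 3) (B : ℤ), 2 * B = ((![n₁, n₂, n₃] : Fin 3 → ℕ) i : ℤ) - d + 2 - 2 * shift d t →
        ((∑ s : Fin 3 → Bool,
            (![(if s 1 then -1 else 1) * (if s 2 then -1 else 1),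
               (if s 0 then -1 else 1) * (if s 2 then -1 else 1),
               (if s 0 then -1 else 1) * (if s 1 then -1 else 1)] : Fin 3 → ℤ) i *
              ({M : Submodule 𝒪[K] (Fin 3 → K) |
                IsVertexLattice σ ϖ (Matrix.diagonal fun j => if s j then c else (1 : K)) 0 M ∧ mapGL T M = M}.ncard : ℤ) : ℤ) : ℚ) =
          2 * ((Ω K σ ϖ d a b i * ((![normSign σ (-1 : K), normSign σ (-1 : K), 1] : Fin 3 → ℤ) i *
            (baseSign σ i * normSign σ (fPartProd δ ![a, b, 1] i))) : ℤ) : ℚ) * ampl (Fintype.card 𝓀[K]) k B ∧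
        ((∑ s : Fin 3 → Bool,
            (![(if s 1 then -1 else 1) * (if s 2 then -1 else 1),
               (if s 0 then -1 else 1) * (if s 2 then -1 else 1),
               (if s 0 then -1 else 1) * (if s 1 then -1 else 1)] : Fin 3 → ℤ) i *
              ({M : Submodule 𝒪[K] (Fin 3 → K) |
                IsVertexLattice σ ϖ (Matrix.diagonal fun j => if s j then c else (1 : K)) 2 M ∧ mapGL T M = M}.ncard : ℤ) : ℤ) : ℚ) =
          2 * ((Ω K σ ϖ d a b i * ((![normSign σ (-1 : K), normSign σ (-1 : K), 1] : Fin 3 → ℤ) i *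
            (baseSign σ i * normSign σ (fPartProd δ ![a, b, 1] i))) : ℤ) : ℚ) * ampl (Fintype.card 𝓀[K]) k (B + τ d)) :
    DyadicFence (K := K) (KappaSignLawAtS2 shift Ω N₀ τ σ ϖ d t) :=
  dyadicFence_of (kappaSignLawAtS2_of_normIndexTwo_of_kappaSignModelSum2_8 shift Ω N₀ τ σ ϖ d t hNI hKSS)

/-- **THE RECORD INSTANCE WITH (NI2) DISCHARGED — the conclusion of the U3 «κS-RECUT» stub `stub_U3_kappaSignLawR2` at the datum from the Ω-aware eightfold (KSS²) alone**: at
`(shiftR, depthOfRecord, tauOfRecord)`, for ANY sign-token schedule `Ω`, (KSS²) implies `DyadicFence (KappaSignLawAtR2 Ω depthOfRecord tauOfRecord σ ϖ d t)`; (NI2) is ★ `normIndexTwo`.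
The composition the recut edition writes (SHAPE MEMO v1 §2): `stub_U3_kappaSignLawR2 := fun σ ϖ d t h2 hD => dyadicFence_kappaSignLawAtR2_of_kappaSignModelSum2_8 ΩR σ ϖ d t
(stub_U3_kappaSignModelSum2 σ ϖ d t h2 hD) h2 hD`.  Nothing is claimed about (KSS²): it is a BINDER. [cite: Rogawski1990, §4.9 Prop. 4.9.1 (a) p. 55] [cite: LanglandsShelstad1987, §1.3] -/
theorem dyadicFence_kappaSignLawAtR2_of_kappaSignModelSum2_8 (Ω : OmegaSchedule) (σ : K →+* K) (ϖ : K) (d t : ℕ)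
    (hKSS : ∀ c : K, σ c = c → Valued.v c = 1 → (∀ x : K, σ x = x → x ≠ 0 → (∃ z : K, z * σ z = x) ∨ ∃ z : K, z * σ z = c * x) →
      ∀ (δ : K), σ δ = -δ → δ ≠ 0 →
      ∀ (a b : K), a * σ a = 1 → b * σ b = 1 → Valued.v (a - 1) < Valued.v (2 : K) → Valued.v (b - 1) < Valued.v (2 : K) →
      ∀ (n₁ n₂ n₃ : ℕ), IsElementDatum σ ϖ (depthOfRecord d) (a * a) (b * b) n₁ n₂ n₃ →
      ∀ (T : GL (Fin 3) K), (T : Matrix (Fin 3) (Fin 3) K) = Matrix.diagonal ![a * a, b * b, 1] →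
      ∀ (k : ℕ), 2 * k + d = n₁ + n₂ + n₃ + 2 →
      ∀ (i : Fin 3) (B : ℤ), 2 * B = ((![n₁, n₂, n₃] : Fin 3 → ℕ) i : ℤ) - d + 2 - 2 * shiftR d t →
        ((∑ s : Fin 3 → Bool,
            (![(if s 1 then -1 else 1) * (if s 2 then -1 else 1),
               (if s 0 then -1 else 1) * (if s 2 then -1 else 1),
               (if s 0 then -1 else 1) * (if s 1 then -1 else 1)] : Fin 3 → ℤ) i *
              ({M : Submodule 𝒪[K] (Fin 3 → K) |
                IsVertexLattice σ ϖ (Matrix.diagonal fun j => if s j then c else (1 : K)) 0 M ∧ mapGL T M = M}.ncard : ℤ) : ℤ) : ℚ) =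
          2 * ((Ω K σ ϖ d a b i * ((![normSign σ (-1 : K), normSign σ (-1 : K), 1] : Fin 3 → ℤ) i *
            (baseSign σ i * normSign σ (fPartProd δ ![a, b, 1] i))) : ℤ) : ℚ) * ampl (Fintype.card 𝓀[K]) k B ∧
        ((∑ s : Fin 3 → Bool,
            (![(if s 1 then -1 else 1) * (if s 2 then -1 else 1),
               (if s 0 then -1 else 1) * (if s 2 then -1 else 1),
               (if s 0 then -1 else 1) * (if s 1 then -1 else 1)] : Fin 3 → ℤ) i *
              ({M : Submodule 𝒪[K] (Fin 3 → K) |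
                IsVertexLattice σ ϖ (Matrix.diagonal fun j => if s j then c else (1 : K)) 2 M ∧ mapGL T M = M}.ncard : ℤ) : ℤ) : ℚ) =
          2 * ((Ω K σ ϖ d a b i * ((![normSign σ (-1 : K), normSign σ (-1 : K), 1] : Fin 3 → ℤ) i *
            (baseSign σ i * normSign σ (fPartProd δ ![a, b, 1] i))) : ℤ) : ℚ) * ampl (Fintype.card 𝓀[K]) k (B + tauOfRecord d)) :
    DyadicFence (K := K) (KappaSignLawAtR2 Ω depthOfRecord tauOfRecord σ ϖ d t) := by
  intro _ hD
  exact kappaSignLawAtS2_of_normIndexTwo_of_kappaSignModelSum2_8 shiftR Ω depthOfRecord tauOfRecord σ ϖ d t (normIndexTwo σ ϖ d t hD) hKSS hD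

end Reduction

end Summit.HodgeConjecture.HodgeConjecture.Cruxes.H413.F0P3cDyRamKappaSignLawR2OfKappaSignModelSum

end
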